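import Mathlib
import HarnessLib
import Literature.Probability.Process.PointStationaryLaw
import Literature.Probability.Process.RootedHardCoreVague
import Summits.AtomisticToContinuum.Crystallization.Theorems.PalmUnimodularRigidityBenjaminiSchrammLimitEmbedding

/-!
# Ergodic reduction for the crux `AperiodicFrustratedLawGap` — pull-back to the configuration space

Route `FrustratedLawDichotomy`, crux `AperiodicFrustratedLawGap` (item `stmt-AtomisticToContinuum-27623`),
registered stub `stub_ergodicReduction` (skeleton `dd3251ad731e`).  Companion of
`FrustratedLawDichotomyAperiodicFrustratedLawGapErgodicReduction`: there the stub is reduced to the ergodic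
decomposition of point-stationary hard-core laws (`ergodicReduction_of_decomposition`, hypothesis `hdec`).
The decomposition has to be built on the compact metric (standard Borel) space
`RootedHardCoreConfig ℝ³ δ` of rooted `δ`-hard-core configurations, where regular conditional laws exist,
and pushed back along the counting-measure embedding `ι : S ↦ count|S`
(`BenjaminiSchrammLimit.measurableEmbedding_toMeasure`).  This file lands the two transfer steps of that
plan which do not involve conditioning:

* `range_toMeasure_eq` — the range of `ι` is exactly the set of rooted `δ`-hard-core counting measures;
  `exists_map_toMeasure_eq` — **pull-back**: a probability law `P` on `Measure ℝ³` carried by rooted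
  `δ`-hard-core configurations is the push-forward `Q.map ι` of a probability law `Q` on the configuration
  space (`Q = P.comap ι`, Lusin–Souslin through `MeasurableEmbedding.map_comap`);
* `toMeasure_mem_iff_reroot_mem` — a set of measures invariant under re-rooting at atoms pulls back to a
  set of configurations invariant under `RootedHardCoreConfig.reroot`;
  `ergodic_map_toMeasure` — **push-forward of ergodicity**: if `Q'` is trivial on every measurable
  re-rooting-invariant set of configurations, then `Q'.map ι` is trivial on every measurable set of measures
  invariant under re-rooting at atoms (the ergodicity clause `ERG` of `S_ergodicReduction` /
  `S_aperiodicErgodicGap`).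

With `BenjaminiSchrammLimit.isPointStationaryLaw_map_toMeasure` (Campbell-invariance on the configuration
space ⇒ Mecke identity of the push-forward) these are steps D1, D2, D6 of the decomposition plan; the
conditioning steps (a.e. Campbell-invariance and a.e. ergodicity of the conditional laws given the
invariant σ-algebra) remain.  All `[folklore]`.
-/

noncomputable section

namespace Summit.AtomisticToContinuum.Crystallization.Theorems.FrustratedLawDichotomyErgodicReduction

open MeasureTheory Set Filter
open scoped ENNReal
open Literature.Probability.Process (IsRootedHardCore IsPointStationaryLaw LocalConfig
  count_restrict_singleton_ne_zero_iff)
open Literature.Probability.Process.LocalConfig (RootedHardCoreConfig toMeasure_def)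
open Summit.AtomisticToContinuum.Crystallization.Theorems.BenjaminiSchrammLimit (measurableEmbedding_toMeasure)

variable {δ : ℝ}

/-! ### The range of the counting-measure embedding -/

/-- **The range of `S ↦ count|S`** on rooted `δ`-hard-core configurations of `ℝ³` is exactly the set of
rooted `δ`-hard-core counting measures `IsRootedHardCore δ`. [folklore] -/
theorem range_toMeasure_eq (δ : ℝ) :
    Set.range (fun S : RootedHardCoreConfig (EuclideanSpace ℝ (Fin 3)) δ =>
      (S.1 : LocalConfig (EuclideanSpace ℝ (Fin 3))).toMeasure) =
      {μ : Measure (EuclideanSpace ℝ (Fin 3)) | IsRootedHardCore δ μ} := by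
  ext μ
  constructor
  · rintro ⟨S, rfl⟩
    exact ⟨((S.1 : LocalConfig (EuclideanSpace ℝ (Fin 3))) : Set (EuclideanSpace ℝ (Fin 3))),
      S.2.1, S.2.2, toMeasure_def _⟩
  · rintro ⟨S, h0, hsep, rfl⟩
    exact ⟨⟨LocalConfig.mk S, h0, hsep⟩, toMeasure_def _⟩

/-- Almost surely hard-core laws are carried by the range of the embedding. [folklore] -/
theorem ae_mem_range_toMeasure {P : Measure (Measure (EuclideanSpace ℝ (Fin 3)))}
    (hcore : ∀ᵐ μ ∂P, IsRootedHardCore δ μ) :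
    ∀ᵐ μ ∂P, μ ∈ Set.range (fun S : RootedHardCoreConfig (EuclideanSpace ℝ (Fin 3)) δ =>
      (S.1 : LocalConfig (EuclideanSpace ℝ (Fin 3))).toMeasure) := by
  rw [range_toMeasure_eq]
  exact hcore

/-! ### Pull-back of an almost surely hard-core law to the configuration space -/

/-- **Pull-back (step D1).**  For `δ > 0`, a probability law `P` on `Measure ℝ³` which is almost surely
a rooted `δ`-hard-core counting measure is the push-forward along `ι : S ↦ count|S` of a probability law
`Q` on the compact configuration space `RootedHardCoreConfig ℝ³ δ` — namely `Q = P.comap ι`, by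
Lusin–Souslin (`measurableEmbedding_toMeasure`, `MeasurableEmbedding.map_comap`) and
`P (range ι)ᶜ = 0`. [folklore] -/
theorem exists_map_toMeasure_eq [Fact (0 < δ)] {P : Measure (Measure (EuclideanSpace ℝ (Fin 3)))}
    [IsProbabilityMeasure P] (hcore : ∀ᵐ μ ∂P, IsRootedHardCore δ μ) :
    ∃ Q : Measure (RootedHardCoreConfig (EuclideanSpace ℝ (Fin 3)) δ), IsProbabilityMeasure Q ∧
      Q.map (fun S => (S.1 : LocalConfig (EuclideanSpace ℝ (Fin 3))).toMeasure) = P := by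
  have hE := measurableEmbedding_toMeasure (EuclideanSpace ℝ (Fin 3)) (δ := δ)
  have hmap : (P.comap fun S : RootedHardCoreConfig (EuclideanSpace ℝ (Fin 3)) δ =>
      (S.1 : LocalConfig (EuclideanSpace ℝ (Fin 3))).toMeasure).map
        (fun S => (S.1 : LocalConfig (EuclideanSpace ℝ (Fin 3))).toMeasure) = P := by
    rw [hE.map_comap, Measure.restrict_eq_self_of_ae_mem (ae_mem_range_toMeasure hcore)]
  refine ⟨P.comap _, ⟨?_⟩, hmap⟩
  rw [← Set.preimage_univ (f := fun S : RootedHardCoreConfig (EuclideanSpace ℝ (Fin 3)) δ =>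
      (S.1 : LocalConfig (EuclideanSpace ℝ (Fin 3))).toMeasure),
    ← Measure.map_apply hE.measurable MeasurableSet.univ, hmap, measure_univ]

/-- Conversely, a push-forward along `ι` of any law on the configuration space is almost surely rooted
`δ`-hard-core. [folklore] -/
theorem ae_isRootedHardCore_map_toMeasure [Fact (0 < δ)]
    (Q : Measure (RootedHardCoreConfig (EuclideanSpace ℝ (Fin 3)) δ)) :
    ∀ᵐ μ ∂(Q.map fun S : RootedHardCoreConfig (EuclideanSpace ℝ (Fin 3)) δ =>
      (S.1 : LocalConfig (EuclideanSpace ℝ (Fin 3))).toMeasure), IsRootedHardCore δ μ := by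
  have hE := measurableEmbedding_toMeasure (EuclideanSpace ℝ (Fin 3)) (δ := δ)
  rw [hE.ae_map_iff]
  refine Eventually.of_forall fun S => ?_
  have : (S.1 : LocalConfig (EuclideanSpace ℝ (Fin 3))).toMeasure ∈
      {μ : Measure (EuclideanSpace ℝ (Fin 3)) | IsRootedHardCore δ μ} := by
    rw [← range_toMeasure_eq]
    exact ⟨S, rfl⟩
  exact this

/-! ### Invariant sets pull back to invariant sets; ergodicity pushes forward -/

/-- **Invariant sets of measures pull back to invariant sets of configurations (step D2).**  If a set
`A` of measures on `ℝ³` is invariant under re-rooting at atoms (`μ {p} ≠ 0 → (μ ∈ A ↔ θ_p μ ∈ A)`), then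
for every rooted hard-core configuration `S` and every point `y ∈ S`:
`count|S ∈ A ↔ count|(S - y) ∈ A` (`toMeasure_reroot`: `count|(S - y) = θ_y count|S`). [folklore] -/
theorem toMeasure_mem_iff_reroot_mem {A : Set (Measure (EuclideanSpace ℝ (Fin 3)))}
    (hinv : ∀ μ : Measure (EuclideanSpace ℝ (Fin 3)), ∀ p : EuclideanSpace ℝ (Fin 3), μ {p} ≠ 0 →
      (μ ∈ A ↔ Measure.map (fun z : EuclideanSpace ℝ (Fin 3) => z - p) μ ∈ A))
    (S : RootedHardCoreConfig (EuclideanSpace ℝ (Fin 3)) δ) (y : EuclideanSpace ℝ (Fin 3))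
    (hy : y ∈ ((S.1 : LocalConfig (EuclideanSpace ℝ (Fin 3))) : Set (EuclideanSpace ℝ (Fin 3)))) :
    (S.1 : LocalConfig (EuclideanSpace ℝ (Fin 3))).toMeasure ∈ A ↔
      ((S.reroot y hy).1 : LocalConfig (EuclideanSpace ℝ (Fin 3))).toMeasure ∈ A := by
  rw [RootedHardCoreConfig.toMeasure_reroot]
  refine hinv _ y ?_
  rw [toMeasure_def]
  exact (count_restrict_singleton_ne_zero_iff _ y).2 hy

/-- **Ergodicity pushes forward along the embedding (step D6).**  If a law `Q'` on rooted `δ`-hard-core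
configurations (`δ > 0`) gives measure `0` or co-measure `0` to every measurable set of configurations
invariant under re-rooting (`S ∈ B ↔ S - y ∈ B` for all `y ∈ S`), then its push-forward `Q'.map ι` gives
measure `0` or co-measure `0` to every measurable set of measures invariant under re-rooting at atoms —
the ergodicity clause of `S_ergodicReduction` / `S_aperiodicErgodicGap`. [folklore] -/
theorem ergodic_map_toMeasure [Fact (0 < δ)]
    {Q' : Measure (RootedHardCoreConfig (EuclideanSpace ℝ (Fin 3)) δ)}
    (herg : ∀ B : Set (RootedHardCoreConfig (EuclideanSpace ℝ (Fin 3)) δ), MeasurableSet B →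
      (∀ (S : RootedHardCoreConfig (EuclideanSpace ℝ (Fin 3)) δ) (y : EuclideanSpace ℝ (Fin 3))
        (hy : y ∈ ((S.1 : LocalConfig (EuclideanSpace ℝ (Fin 3))) : Set (EuclideanSpace ℝ (Fin 3)))),
        S ∈ B ↔ S.reroot y hy ∈ B) → Q' B = 0 ∨ Q' Bᶜ = 0) :
    ∀ A : Set (Measure (EuclideanSpace ℝ (Fin 3))), MeasurableSet A →
      (∀ μ : Measure (EuclideanSpace ℝ (Fin 3)), ∀ p : EuclideanSpace ℝ (Fin 3), μ {p} ≠ 0 →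
        (μ ∈ A ↔ Measure.map (fun z : EuclideanSpace ℝ (Fin 3) => z - p) μ ∈ A)) →
      (Q'.map fun S : RootedHardCoreConfig (EuclideanSpace ℝ (Fin 3)) δ =>
          (S.1 : LocalConfig (EuclideanSpace ℝ (Fin 3))).toMeasure) A = 0 ∨
        (Q'.map fun S : RootedHardCoreConfig (EuclideanSpace ℝ (Fin 3)) δ =>
          (S.1 : LocalConfig (EuclideanSpace ℝ (Fin 3))).toMeasure) Aᶜ = 0 := by
  have hE := measurableEmbedding_toMeasure (EuclideanSpace ℝ (Fin 3)) (δ := δ)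
  intro A hA hinv
  rw [Measure.map_apply hE.measurable hA, Measure.map_apply hE.measurable hA.compl, preimage_compl]
  exact herg _ (hE.measurable hA) fun S y hy => toMeasure_mem_iff_reroot_mem hinv S y hy

end Summit.AtomisticToContinuum.Crystallization.Theorems.FrustratedLawDichotomyErgodicReduction

end
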